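import Mathlib
import Literature.MathematicalPhysics.StatisticalMechanics.Crystallization

/-!
# Two-cone witness `R2` in Bernstein coordinates — definitions (line `Sketch`, crux
`OnePercentCertificate`, stmt-AtomisticToContinuum-11958)

`f2 r = Σ α_m e^{−t_m r²} − κ·bernsteinTail T r` with 6 signed Gaussian atoms on the square grid
`t = (j/q)²`, tail `T = 1`, `κ = (1+η)/12`, `η = 1/50`; value `f2 0 / 2 = 0.936518`
(generated by numerics/rung2/gen.py from the LP solution).
-/

noncomputable section

namespace Summit.AtomisticToContinuum.Crystallization.Theorems.TwoConeR2

open Literature.MathematicalPhysics.StatisticalMechanics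

/-- The Bochner-cone witness `f2` (6 signed Gaussian atoms + exact Bernstein tail piece,
`κ = 17/200`, `T = 1`). [folklore] -/
def f2 (r : ℝ) : ℝ :=
  (-(269031 / 100000000)) * Real.exp (-(4 / 9) * r ^ 2) + (-(1684007 / 50000000)) * Real.exp (-(25 / 36) * r ^ 2) + (3098643 / 25000000) * Real.exp (-(1) * r ^ 2) + (-(4125349 / 100000000)) * Real.exp (-(16 / 9) * r ^ 2) + (-(477339991 / 100000000)) * Real.exp (-(9 / 4) * r ^ 2) + (662844703 / 100000000) * Real.exp (-(25 / 9) * r ^ 2) - (17 / 200) * ∫ t in (0 : ℝ)..(1), t ^ 2 * Real.exp (-t * r ^ 2)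

/-- `f2 0 = 56191067/30000000` hence the certificate value `f2 0 / 2`. -/
theorem f2_zero : f2 0 = (56191067 / 30000000) := by
  simp only [f2]
  norm_num [integral_pow]

end Summit.AtomisticToContinuum.Crystallization.Theorems.TwoConeR2
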